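import Literature.AlgebraicGeometry.Resolution.KunzRegularityCriterionProofs
import Literature.RingTheory.TightClosure.TightClosure
import Mathlib.RingTheory.RegularLocalRing.Defs
import HarnessLib

/-!
# The Hilbert–Kunz function of a regular local ring: `ℓ(R/𝔪^[pⁿ]) = p^(n·d)`

Route `FrobeniusLadder`, crux `FRationalResolution` (stmt-ResolutionOfSingularities-15317), line
`Sketch`, idea card `frobenius-flattening`, first lemma `KunzDefect` — Kunz's regularity criterion in
length form: for a Noetherian local ring `(R, 𝔪)` of prime characteristic `p` and dimension `d`,
`p^d ≤ ℓ(R/𝔪^[p])` with equality iff `R` is regular. This file is the REGULAR direction: a regular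
local ring `R` of characteristic `p` and dimension `d` has `ℓ_R(R/𝔪^[pⁿ]) = p^(n·d)` for every `n`,
where `𝔪^[q] = span {z ^ q | z ∈ 𝔪}` is the Frobenius power in its inline form (the body of
`Literature.RingTheory.TightClosure.frobeniusPower`).

Proof: the Frobenius of a regular local ring is flat (Kunz 1969, Thm. 2.1;
`Literature.AlgebraicGeometry.Resolution.flat_frobenius_of_isRegularLocalRing`). Write
`𝔪 = (x₁, …, x_r)` minimally (`Kunz1969.exists_span_range_eq`), so that `r = d` by regularity; then
`𝔪^[pⁿ] = (x₁^(pⁿ), …, x_r^(pⁿ))` (`frobeniusPower_span`) and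
`ℓ(R/(x₁^(pⁿ), …, x_r^(pⁿ))) = (pⁿ)^r` for a flat Frobenius
(`Kunz1969.length_quotient_frobeniusPower_eq`, Stacks 0EC0 through the Lech lemmas 0EBY/0EBZ).

## References

* [Kunz1969] E. Kunz, *Characterizations of regular local rings of characteristic `p`*, Amer. J.
  Math. 91 (1969) 772–784, Thm. 2.1 and Prop. 3.2 / Thm. 3.3 (`ℓ(R/𝔪^[q]) = q^d` iff `R` regular).
* [StacksProject] Tag 0EC0 (Lemma 51.17.6 (Kunz)), proof.
-/

-- single-problem summit: the doubled namespace component is forced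
set_option linter.dupNamespace false

noncomputable section

open IsLocalRing Literature.RingTheory.TightClosure Literature.AlgebraicGeometry.Resolution

namespace Summit.ResolutionOfSingularities.ResolutionOfSingularities.Theorems.FRationalResolution

/-- The inline Frobenius power of the ideal generated by a family `x` is generated by the powers of
the members of the family: `span {z ^ (p ^ n) | z ∈ (xᵢ)ᵢ} = (xᵢ ^ (p ^ n))ᵢ`.
[cite: QuyShimomoto2017, §2 (`I^[q] := (x₁^q, …, x_t^q)`)] -/
theorem length_quotient_frobeniusPower_maximalIdeal_span_image_eq {R : Type*} [CommRing R]
    (p : ℕ) [ExpChar R p] (n : ℕ) {ι : Type*} (x : ι → R) :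
    Ideal.span ((fun z : R => z ^ p ^ n) '' (Ideal.span (Set.range x) : Set R)) =
      Ideal.span (Set.range fun i => x i ^ p ^ n) := by
  rw [← frobeniusPower_def (p ^ n) (Ideal.span (Set.range x)), frobeniusPower_span p n (Set.range x),
    ← Set.range_comp]
  rfl

/-- **Kunz: the Hilbert–Kunz function of a regular local ring is `q^d`.** For a regular local ring
`(R, 𝔪)` of prime characteristic `p` and Krull dimension `d`, and every `n`,
`ℓ_R(R/𝔪^[pⁿ]) = p^(n·d)`, where `𝔪^[pⁿ] = span {z ^ (p ^ n) | z ∈ 𝔪}`. Proof: the Frobenius is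
flat (`flat_frobenius_of_isRegularLocalRing`, Kunz 1969 Thm. 2.1); with `𝔪 = (x₁, …, x_d)` a
minimal (= regular) system of generators, `𝔪^[pⁿ] = (x₁^(pⁿ), …, x_d^(pⁿ))` and
`ℓ(R/(x₁^(pⁿ), …, x_d^(pⁿ))) = (pⁿ)^d` (`Kunz1969.length_quotient_frobeniusPower_eq`).
[cite: Kunz1969, Thm. 2.1 with Prop. 3.2; StacksProject, Tag 0EC0 (proof)] -/
theorem length_quotient_frobeniusPower_maximalIdeal_of_isRegularLocalRing (p : ℕ) [Fact p.Prime] (R : Type) [CommRing R] [IsRegularLocalRing R] [CharP R p] {d : ℕ} (hd : ringKrullDim R = d) (n : ℕ) : Module.length R (R ⧸ Ideal.span ((fun x : R => x ^ p ^ n) '' (IsLocalRing.maximalIdeal R : Set R))) = ((p ^ (n * d) : ℕ) : ℕ∞) := by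
  -- `𝔪 = (x₁, …, x_r)` minimally, `r = spanFinrank 𝔪 = d` by regularity
  obtain ⟨x, hx⟩ := Kunz1969.exists_span_range_eq (maximalIdeal R)
  have hr : (maximalIdeal R).spanFinrank = d := by
    have h := IsRegularLocalRing.spanFinrank_maximalIdeal (R := R)
    rw [hd] at h
    exact_mod_cast h
  -- `𝔪^[pⁿ] = (x₁^(pⁿ), …, x_r^(pⁿ))`
  have hI : Ideal.span ((fun z : R => z ^ p ^ n) '' (maximalIdeal R : Set R)) =
      Ideal.span (Set.range fun i => x i ^ p ^ n) := by
    rw [← length_quotient_frobeniusPower_maximalIdeal_span_image_eq p n x, hx]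
  rw [hI, Kunz1969.length_quotient_frobeniusPower_eq (flat_frobenius_of_isRegularLocalRing p R) x hx
    rfl n, hr, ← pow_mul]

end Summit.ResolutionOfSingularities.ResolutionOfSingularities.Theorems.FRationalResolution

end
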